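import Literature.Barriers.RiemannHypothesis.TuranPartialSumsBohr
import HarnessLib

/-!
# Spira's criterion for zeros of the sections `ζ_N` beyond `σ = 1` (Spira 1968, §4), proved

Barrier catalogue `Literature/Barriers/RiemannHypothesis/`, companion of `TuranPartialSums.lean`
(`zetaPartialSum`, the named fact `PlattTrudgian2016_thm11`), `TuranPartialSumsAssembly.lean` (its
existence inputs `Spira1968_exists_zero`, `vandeLuneTeRiele1982_exists_zero`) and
`TuranPartialSumsBohr.lean` (Bohr's transfer of zeros from twisted sections to `ζ_N`,
`exists_zetaPartialSum_zero_of_twist_zero`).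

Spira 1968, §4 (p. 173): "Since `|F*_N| → 1` and `∑_{p ∈ P_N} p^{−σ} → 0` as `σ → ∞`, if we find
values of the variables `x₁, …`, so that `|F*_N(1, x₁, …)| − ∑_{p ∈ P_N} 1/p < 0`, then
`F_N(σ, x₁, …)` has a root with `σ > 1`. Thus, from Table III, for `N = 19`, `23` to `27` and `29` to
`50`, `F_N` has roots with `σ > 1`." Here `P_N` is the set of primes in `(N/2, N]` (each occurs in
exactly one term of `ζ_N`), `F_N` is the companion (torus) function of `ζ_N` and `F*_N` the part of
it free of the primes of `P_N` (§2, (5)–(8)); by Bohr's equivalence (§2) a root of `F_N` with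
`σ > 1` gives zeros of `ζ_N(s)` with `σ > 1`.

## Main result (sorry-free)

* `primeTwist f` — the completely multiplicative function with prescribed values `f p` at the
  primes (`∏_{p^k ‖ n} f(p)^k`, as a product over `Nat.primeFactorsList`, so that `simp` evaluates it
  at numerals); `primeTwist_mul`, `primeTwist_prime`, `norm_primeTwist`.
* `exists_zetaPartialSum_zero_of_spira_criterion` (**Spira's criterion**): let `N ≥ 1`,
  `Icc 1 N = G ∪ P` with `P` a nonempty set of primes none of which divides an element of `G`, and
  `f` unimodular at the primes. If `‖∑_{n ∈ G} f̃(n)/n‖ < ∑_{p ∈ P} 1/p` (`f̃ = primeTwist f`), then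
  `ζ_N` has a zero with `σ > 1`. Proof: `g(σ) = ‖∑_{G} f̃(n) n^{−σ}‖ − ∑_{P} p^{−σ}` is continuous,
  `g(1) < 0` (the hypothesis) and `g(2) ≥ 1/N > 0` (telescoping), so `g(σ₀) = 0` for some
  `σ₀ ∈ (1, 2]`; re-phasing `f` on `P` to point against `F*(σ₀) = ∑_{G} f̃(n) n^{−σ₀}` gives a
  completely multiplicative unimodular twist whose twisted section VANISHES at `σ₀ > 1`, and
  `exists_zetaPartialSum_zero_of_twist_zero` (Kronecker + Hurwitz) transfers this zero to `ζ_N`.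
  The certificates (rational points on the unit circle for `f(p)`, `p ≤ N/2`) for the individual
  `N` of Spira's table are in the companion files `TuranPartialSumsSpiraCertificates*.lean`.

## References

* [Spira1968] R. Spira, *Zeros of sections of the zeta function. II*, Math. Comp. 22 (1968),
  163–173: §2 (companion function, (5)–(8), Bohr equivalence), §4 p. 173 (the criterion, Table III).
* [Apostol1990] T. M. Apostol, *Modular Functions and Dirichlet Series in Number Theory*, 2nd ed.,
  §8.11 Thm. 8.16 (Bohr's equivalence theorem), through `TuranPartialSumsBohr.lean`.
-/

noncomputable section

open Complex Finset

namespace Literature.Barriers.RiemannHypothesis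

/-! ## Completely multiplicative functions with prescribed prime values -/

/-- The completely multiplicative function with values `f p` at the primes:
`primeTwist f n = ∏ f(q)` over the prime factors `q` of `n` listed with multiplicity
(`Nat.primeFactorsList`; so `primeTwist f 12 = f 2 · f 2 · f 3`, `primeTwist f 1 = 1`, and the junk
value `primeTwist f 0 = 1`). Spira's companion-function variables `x_j = t log p_j` enter `ζ_N` only
through such a twist (§2, (2)–(3)). (Cf. `Literature.NumberTheory.LFunctions.cmLift`, the same
object as an `ArithmeticFunction` via `Nat.factorization`; the list form is used here because `simp`
evaluates it at numerals.) [cite: Spira1968, §2 (2)–(3)] -/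
def primeTwist (f : ℕ → ℂ) (n : ℕ) : ℂ :=
  (n.primeFactorsList.map f).prod

/-- `primeTwist f 1 = 1`. [folklore] -/
@[simp] theorem primeTwist_one (f : ℕ → ℂ) : primeTwist f 1 = 1 := by
  simp [primeTwist]

/-- At a prime, `primeTwist f p = f p`. [folklore] -/
theorem primeTwist_prime (f : ℕ → ℂ) {p : ℕ} (hp : p.Prime) : primeTwist f p = f p := by
  simp [primeTwist, Nat.primeFactorsList_prime hp]

/-- Complete multiplicativity: `primeTwist f (m n) = primeTwist f m · primeTwist f n` for
`m, n ≠ 0`. [folklore] -/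
theorem primeTwist_mul (f : ℕ → ℂ) {m n : ℕ} (hm : m ≠ 0) (hn : n ≠ 0) :
    primeTwist f (m * n) = primeTwist f m * primeTwist f n := by
  unfold primeTwist
  rw [← List.prod_append, ← List.map_append]
  exact ((Nat.perm_primeFactorsList_mul hm hn).map f).prod_eq

/-- `primeTwist f n` depends only on the values of `f` at the prime factors of `n`. [folklore] -/
theorem primeTwist_congr {f g : ℕ → ℂ} {n : ℕ} (h : ∀ q ∈ n.primeFactorsList, f q = g q) :
    primeTwist f n = primeTwist g n := by
  unfold primeTwist
  rw [List.map_congr_left h]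

/-- If `|f(p)| = 1` at every prime then `|primeTwist f n| = 1` for every `n`. [folklore] -/
theorem norm_primeTwist (f : ℕ → ℂ) (hf : ∀ p : ℕ, p.Prime → ‖f p‖ = 1) (n : ℕ) :
    ‖primeTwist f n‖ = 1 := by
  have key : ∀ l : List ℕ, (∀ q ∈ l, q.Prime) → ‖(l.map f).prod‖ = 1 := by
    intro l
    induction l with
    | nil => intro; simp
    | cons a l ih =>
      intro h
      rw [List.map_cons, List.prod_cons, norm_mul, hf a (h a (by simp)),
        ih (fun q hq ↦ h q (by simp [hq])), one_mul]
  exact key _ fun q hq ↦ Nat.prime_of_mem_primeFactorsList hq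

/-! ## Spira's criterion -/

/-- `∑_{n=1}^{N} n^{−2} ≤ 2 − 1/N` (`n^{−2} ≤ 1/(n(n−1))` and telescoping). [folklore] -/
theorem sum_Icc_rpow_neg_two_le {N : ℕ} (hN : 1 ≤ N) :
    ∑ n ∈ Finset.Icc 1 N, (n : ℝ) ^ (-(2 : ℝ)) ≤ 2 - 1 / (N : ℝ) := by
  rw [Finset.Icc_eq_cons_Ioc hN, Finset.sum_cons,
    show Finset.Ioc 1 N = Finset.Icc 2 N from (Finset.Icc_add_one_left_eq_Ioc 1 N).symm]
  have htel := sum_Icc_one_div_mul_pred hN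
  have h1 : ((1 : ℕ) : ℝ) ^ (-(2 : ℝ)) = 1 := by simp
  rw [h1]
  have : ∑ n ∈ Finset.Icc 2 N, (n : ℝ) ^ (-(2 : ℝ)) ≤
      ∑ n ∈ Finset.Icc 2 N, 1 / ((n : ℝ) * ((n : ℝ) - 1)) := by
    refine Finset.sum_le_sum fun n hn ↦ ?_
    rw [Finset.mem_Icc] at hn
    have hnR : (2 : ℝ) ≤ n := by exact_mod_cast hn.1
    rw [Real.rpow_neg (by linarith), Real.rpow_two, ← one_div, sq]
    exact one_div_le_one_div_of_le (by nlinarith) (by nlinarith)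
  linarith

/-- **Spira's criterion** (Spira 1968, §4, p. 173: "if we find values of the variables `x₁, …`, so
that `|F*_N(1, x₁, …)| − ∑_{p ∈ P_N} 1/p < 0`, then `F_N(σ, x₁, …)` has a root with `σ > 1`", and
then, §2, `ζ_N` has zeros with `σ > 1`). Formulation: `N ≥ 1`; `Icc 1 N = G ∪ P` with `P` a
nonempty set of primes none of which is a prime factor of an element of `G` (for Spira, `P` = the
primes in `(N/2, N]`); `f` unimodular at the primes (the phases `e^{−i x_j}`); and
`‖∑_{n ∈ G} f̃(n)/n‖ < ∑_{p ∈ P} 1/p` with `f̃ = primeTwist f`. Then `ζ_N(s) = 0` for some `s` with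
`Re s > 1`. Proof: intermediate value theorem for `σ ↦ ‖∑_G f̃(n)n^{−σ}‖ − ∑_P p^{−σ}` on `[1, 2]`,
re-phasing of `f` on `P`, and Bohr's transfer `exists_zetaPartialSum_zero_of_twist_zero`.
[cite: Spira1968, §4 p. 173 and §2] -/
theorem exists_zetaPartialSum_zero_of_spira_criterion {N : ℕ} (hN : 1 ≤ N) (f : ℕ → ℂ)
    (hf : ∀ p : ℕ, p.Prime → ‖f p‖ = 1) (G P : Finset ℕ) (hU : Finset.Icc 1 N = G ∪ P)
    (hP : ∀ p ∈ P, p.Prime) (hPne : P.Nonempty) (hG : ∀ n ∈ G, ∀ q ∈ n.primeFactorsList, q ∉ P)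
    (hcrit : ‖∑ n ∈ G, primeTwist f n / (n : ℂ)‖ < ∑ p ∈ P, (1 : ℝ) / p) :
    ∃ s : ℂ, 1 < s.re ∧ zetaPartialSum N s = 0 := by
  classical
  -- bookkeeping on `G` and `P`
  have hP0 : ∀ p ∈ P, (0 : ℝ) < p := fun p hp ↦ by exact_mod_cast (hP p hp).pos
  have hD : Disjoint G P := by
    rw [Finset.disjoint_left]
    intro n hnG hnP
    have hn := hP n hnP
    exact hG n hnG n ((Nat.mem_primeFactorsList hn.ne_zero).2 ⟨hn, dvd_rfl⟩) hnP
  have hG0 : ∀ n ∈ G, n ≠ 0 := by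
    intro n hn h0
    have : n ∈ Finset.Icc 1 N := by rw [hU]; exact Finset.mem_union_left P hn
    rw [Finset.mem_Icc] at this
    omega
  have h1G : 1 ∈ G := by
    have : 1 ∈ Finset.Icc 1 N := by simp [hN]
    rw [hU, Finset.mem_union] at this
    rcases this with h | h
    · exact h
    · exact absurd (hP 1 h) Nat.not_prime_one
  -- the two functions of `σ`
  set Fs : ℝ → ℂ := fun σ ↦ ∑ n ∈ G, primeTwist f n * (n : ℂ) ^ (-(σ : ℂ)) with hFs
  set R : ℝ → ℝ := fun σ ↦ ∑ p ∈ P, (p : ℝ) ^ (-σ) with hR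
  have hFc : Continuous Fs := by
    refine continuous_finsetSum _ fun n hn ↦ continuous_const.mul ?_
    exact Continuous.const_cpow continuous_ofReal.neg (Or.inl (by exact_mod_cast hG0 n hn))
  have hRc : Continuous R := by
    refine continuous_finsetSum _ fun p hp ↦ ?_
    exact continuous_const.rpow continuous_neg fun _ ↦ Or.inl (hP0 p hp).ne'
  set g : ℝ → ℝ := fun σ ↦ ‖Fs σ‖ - R σ with hg
  have hgc : Continuous g := hFc.norm.sub hRc
  -- `g 1 < 0`: the hypothesis
  have hg1 : g 1 < 0 := by
    have e1 : Fs 1 = ∑ n ∈ G, primeTwist f n / (n : ℂ) := by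
      simp only [hFs, ofReal_one, cpow_neg_one, div_eq_mul_inv]
    have e2 : R 1 = ∑ p ∈ P, (1 : ℝ) / p := by
      simp only [hR, Real.rpow_neg_one, one_div]
    simp only [hg]
    rw [e1, e2]
    linarith
  -- `g 2 ≥ 0`: `‖Fs 2‖ ≥ 2 − ∑_G n⁻²` and `R 2 = ∑_{Icc 1 N} n⁻² − ∑_G n⁻² ≤ 2 − 1/N − ∑_G n⁻²`
  have hg2 : 0 ≤ g 2 := by
    have hIcc := sum_Icc_rpow_neg_two_le hN
    have hsplit : ∑ n ∈ Finset.Icc 1 N, (n : ℝ) ^ (-(2 : ℝ)) =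
        ∑ n ∈ G, (n : ℝ) ^ (-(2 : ℝ)) + R 2 := by
      rw [hU, Finset.sum_union hD]
    have eG : ∑ n ∈ G, (n : ℝ) ^ (-(2 : ℝ)) = 1 + ∑ n ∈ G.erase 1, (n : ℝ) ^ (-(2 : ℝ)) := by
      rw [← Finset.add_sum_erase G _ h1G]
      simp
    have e : Fs 2 = 1 + ∑ n ∈ G.erase 1, primeTwist f n * (n : ℂ) ^ (-((2 : ℝ) : ℂ)) := by
      simp only [hFs]
      rw [← Finset.add_sum_erase G _ h1G]
      simp
    have hb : ‖∑ n ∈ G.erase 1, primeTwist f n * (n : ℂ) ^ (-((2 : ℝ) : ℂ))‖ ≤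
        ∑ n ∈ G.erase 1, (n : ℝ) ^ (-(2 : ℝ)) := by
      refine norm_sum_le_of_le _ fun n hn ↦ ?_
      have hn0 : 0 < n := Nat.pos_of_ne_zero (hG0 n (Finset.mem_of_mem_erase hn))
      rw [norm_mul, norm_primeTwist f hf, one_mul, Complex.norm_natCast_cpow_of_pos hn0]
      simp
    have hF2 : 2 - ∑ n ∈ G, (n : ℝ) ^ (-(2 : ℝ)) ≤ ‖Fs 2‖ := by
      rw [e, eG]
      have := norm_sub_norm_le (1 : ℂ)
        (-(∑ n ∈ G.erase 1, primeTwist f n * (n : ℂ) ^ (-((2 : ℝ) : ℂ))))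
      rw [sub_neg_eq_add, norm_one, norm_neg] at this
      linarith
    have hN' : (0 : ℝ) < 1 / (N : ℝ) := by
      have : (0 : ℝ) < N := by exact_mod_cast hN
      positivity
    simp only [hg]
    linarith
  -- intermediate value theorem on `[1, 2]`
  obtain ⟨σ₀, hσ₀, hzero⟩ :=
    intermediate_value_Icc (show (1 : ℝ) ≤ 2 by norm_num) hgc.continuousOn ⟨hg1.le, hg2⟩
  have hσ₀1 : 1 < σ₀ := by
    rcases eq_or_lt_of_le hσ₀.1 with h | h
    · exfalso; rw [← h] at hzero; linarith
    · exact h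
  have hRpos : 0 < R σ₀ := Finset.sum_pos (fun p hp ↦ Real.rpow_pos_of_pos (hP0 p hp) _) hPne
  have hnorm : ‖Fs σ₀‖ = R σ₀ := by
    have : g σ₀ = 0 := hzero
    simp only [hg] at this
    linarith
  have hF0 : Fs σ₀ ≠ 0 := by
    intro h; rw [h, norm_zero] at hnorm; linarith
  have hFn0 : (‖Fs σ₀‖ : ℂ) ≠ 0 := by exact_mod_cast (norm_ne_zero_iff.2 hF0)
  -- re-phase `f` on `P` against `Fs σ₀`
  set u : ℂ := Fs σ₀ / (‖Fs σ₀‖ : ℂ) with hu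
  have hun : ‖u‖ = 1 := by
    rw [hu, norm_div, Complex.norm_real, Real.norm_eq_abs, abs_of_pos (norm_pos_iff.2 hF0),
      div_self (norm_ne_zero_iff.2 hF0)]
  set f' : ℕ → ℂ := fun p ↦ if p ∈ P then -u else f p with hf'
  have hf'1 : ∀ p : ℕ, p.Prime → ‖f' p‖ = 1 := by
    intro p hp
    by_cases h : p ∈ P
    · simp [hf', h, hun]
    · simp [hf', h, hf p hp]
  have hmul : ∀ m n : ℕ, m ≠ 0 → n ≠ 0 →
      primeTwist f' (m * n) = primeTwist f' m * primeTwist f' n :=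
    fun m n hm hn ↦ primeTwist_mul f' hm hn
  have hψ : ∀ p : ℕ, p.Prime → ‖primeTwist f' p‖ = 1 := fun p hp ↦ by
    rw [primeTwist_prime f' hp]; exact hf'1 p hp
  -- the re-phased twisted section vanishes at `σ₀`
  have hvan : twistedPartialSum (primeTwist f') N (σ₀ : ℂ) = 0 := by
    rw [twistedPartialSum, hU, Finset.sum_union hD]
    have eG : ∑ n ∈ G, primeTwist f' n * (n : ℂ) ^ (-(σ₀ : ℂ)) = Fs σ₀ := by
      refine Finset.sum_congr rfl fun n hn ↦ ?_
      rw [primeTwist_congr (g := f) fun q hq ↦ by simp [hf', hG n hn q hq]]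
    have eP : ∑ p ∈ P, primeTwist f' p * (p : ℂ) ^ (-(σ₀ : ℂ)) = -u * (R σ₀ : ℂ) := by
      simp only [hR]
      rw [ofReal_sum, Finset.mul_sum]
      refine Finset.sum_congr rfl fun p hp ↦ ?_
      rw [primeTwist_prime f' (hP p hp)]
      simp only [hf', if_pos hp]
      rw [ofReal_cpow (hP0 p hp).le, ofReal_natCast, ofReal_neg]
    rw [eG, eP, show ((R σ₀ : ℝ) : ℂ) = (‖Fs σ₀‖ : ℂ) by rw [hnorm], hu]
    field_simp
    ring
  -- Bohr's transfer
  obtain ⟨s, hs0, hs1, -⟩ := exists_zetaPartialSum_zero_of_twist_zero hmul hψ hN hvan (c := 1)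
    (by simpa using hσ₀1) 0
  exact ⟨s, hs1, hs0⟩

end Literature.Barriers.RiemannHypothesis
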